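import Mathlib
import HarnessLib
import Summits.QuantumFields.Statement
import Literature.MathematicalPhysics.QuantumLattice.LatticeGaugeDLR

/-!
# Records of the items of route `XiCompleteMonotonicity` used by the `DirichletWindowXiDiverges*` modules

Buildfix ops lane, 2026-08-20 (deprecate-and-add; no accepted statement is edited anywhere).

The route file `Summits/QuantumFields/YangMills/Theses/XiCompleteMonotonicity.lean` (route status: draft) has
not built since the 2026-08-16 re-type of the Yang–Mills summit statement: only its planner-authored `closes`
glue fails (at :427, `sch.HasWeakCouplingLimit`); its ITEMS are unchanged. The three accepted modules
`Theorems/DirichletWindowXiDiverges.lean` (+ `…LogWindow`, `…TorusWindow`, which import it) import that route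
file only to NAME eight of its items as `Theses.XiCompleteMonotonicity.<Item>` from inside
`namespace Summit.QuantumFields.YangMills.Theorems`, and therefore cannot be built by Lake although their own
sources elaborate. This module records those eight items, LEDGER SIGNATURES VERBATIM (each is byte-equal to the
body of `Summit.QuantumFields.YangMills.Theses.XiCompleteMonotonicity.<Item>` in the current route file; five of
them are moreover shared verbatim with the LIVE route `DirichletWindow`), under the namespace
`Summit.QuantumFields.YangMills.Theorems.Theses.XiCompleteMonotonicity`: Lean resolves an identifier against the
current namespace and its prefixes before the root, so inside `namespace Summit.QuantumFields.YangMills.Theorems`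
the unchanged statement text `Theses.XiCompleteMonotonicity.<Item>` denotes the record below — exactly the
proposition each theorem was accepted for — once `DirichletWindowXiDiverges.lean` imports this module instead of
the dead route file. The glue records (8942, 8943) mention their sibling records by short name, as the route file
does. CAVEATS, stated once: (i) if the planners restate one of these items, the records and the theorems typed by
them keep speaking about the signatures recorded here; (ii) the ledger certificate of item stmt-QuantumFields-8942
(`Theorems.xiDivergesOfPolynomial_xiCompleteMonotonicity`) is from now on typed by the record
`…Theorems.Theses.XiCompleteMonotonicity.XiDivergesOfPolynomial` (same text, definitionally the route body); when
the route file builds again a one-line `Iff.rfl`/`id` bridge re-types it by the route decl. These are records of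
ledger ITEMS, not published facts (no citation tags on purpose).
-/

namespace Summit.QuantumFields.YangMills.Theorems.Theses.XiCompleteMonotonicity

/-- Record of item stmt-QuantumFields-8935 `XiCompleteMonotonicity.XiExpLowerBound` (target): ledger signature verbatim —
exponential lower bound on the axial plaquette correlation with rate `m ≤ K β e^{-cβ}`, uniformly over infinite-volume limit points (Chatterjee Problem 5.1 shape). -/
def XiExpLowerBound : Prop :=
  ∀ (G : Type) [Group G] [TopologicalSpace G] [IsTopologicalGroup G] [CompactSpace G] [MeasurableSpace G] [BorelSpace G], Literature.MathematicalPhysics.QuantumFieldTheory.IsCompactSimpleLieGroup G → ∀ r : Literature.MathematicalPhysics.QuantumFieldTheory.LatticeRep G, ∃ β₀ c K : ℝ, 0 < c ∧ ∀ β : ℝ, β₀ ≤ β → ∀ μ ∈ Literature.MathematicalPhysics.QuantumLattice.infiniteVolumeLimitPoints (d := 4) r.ρ β, ∃ m A : ℝ, 0 < A ∧ 0 ≤ m ∧ m ≤ K * β * Real.exp (-(c * β)) ∧ ∀ n : ℕ, A * Real.exp (-(m * n)) ≤ Literature.MathematicalPhysics.QuantumLattice.plaquetteCorrFn r.ρ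 μ ((n : ℤ) • Pi.single (0 : Fin 4) (1 : ℤ))

/-- Record of item stmt-QuantumFields-8937 `XiCompleteMonotonicity.PolynomialWindow` (crux): ledger signature verbatim —
polynomial window: `A/(β² n⁸) ≤ f_β(n e₀)` for `n₀ ≤ n ≤ β^p`, uniformly over limit points. -/
def PolynomialWindow : Prop :=
  ∀ (G : Type) [Group G] [TopologicalSpace G] [IsTopologicalGroup G] [CompactSpace G] [MeasurableSpace G] [BorelSpace G], Literature.MathematicalPhysics.QuantumFieldTheory.IsCompactSimpleLieGroup G → ∀ r : Literature.MathematicalPhysics.QuantumFieldTheory.LatticeRep G, ∃ β₀ p A : ℝ, ∃ n₀ : ℕ, 0 < p ∧ 0 < A ∧ ∀ β : ℝ, β₀ ≤ β → ∀ μ ∈ Literature.MathematicalPhysics.QuantumLattice.infiniteVolumeLimitPoints (d := 4) r.ρ β, ∀ n : ℕ, n₀ ≤ n → (n : ℝ) ≤ β ^ p → A / (β ^ 2 * (n : ℝ) ^ 8) ≤ Literature.MathematicalPhysics.QuantumLattice.plaquetteCorrFn r.ρ μ ((n : ℤ) • Pi.single (0 : Fin 4) (1 : ℤ))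

/-- Record of item stmt-QuantumFields-8938 `XiCompleteMonotonicity.FixedDistanceLower` (crux, shared verbatim with route DirichletWindow): ledger signature verbatim —
fixed-distance leading-order lower asymptotics `A/(β² n⁸) ≤ f_β(n e₀)` for `β ≥ β_n`. -/
def FixedDistanceLower : Prop :=
  ∀ (G : Type) [Group G] [TopologicalSpace G] [IsTopologicalGroup G] [CompactSpace G] [MeasurableSpace G] [BorelSpace G], Literature.MathematicalPhysics.QuantumFieldTheory.IsCompactSimpleLieGroup G → ∀ r : Literature.MathematicalPhysics.QuantumFieldTheory.LatticeRep G, ∃ A : ℝ, ∃ n₀ : ℕ, 0 < A ∧ ∀ n : ℕ, n₀ ≤ n → ∃ β₁ : ℝ, ∀ β : ℝ, β₁ ≤ β → ∀ μ ∈ Literature.MathematicalPhysics.QuantumLattice.infiniteVolumeLimitPoints (d := 4) r.ρ β, A / (β ^ 2 * (n : ℝ) ^ 8) ≤ Literature.MathematicalPhysics.QuantumLattice.plaquetteCorrFn r.ρ μ ((n : ℤ) • Pi.single (0 : Fin 4) (1 : ℤ))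

/-- Record of item stmt-QuantumFields-8939 `XiCompleteMonotonicity.PlaquetteVarianceUpper` (crux, shared verbatim with route DirichletWindow): ledger signature verbatim —
plaquette variance upper bound `f_β(0) ≤ B/β²`. -/
def PlaquetteVarianceUpper : Prop :=
  ∀ (G : Type) [Group G] [TopologicalSpace G] [IsTopologicalGroup G] [CompactSpace G] [MeasurableSpace G] [BorelSpace G], Literature.MathematicalPhysics.QuantumFieldTheory.IsCompactSimpleLieGroup G → ∀ r : Literature.MathematicalPhysics.QuantumFieldTheory.LatticeRep G, ∃ B β₁ : ℝ, ∀ β : ℝ, β₁ ≤ β → ∀ μ ∈ Literature.MathematicalPhysics.QuantumLattice.infiniteVolumeLimitPoints (d := 4) r.ρ β, Literature.MathematicalPhysics.QuantumLattice.plaquetteCorrFn r.ρ μ 0 ≤ B / β ^ 2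

/-- Record of item stmt-QuantumFields-8940 `XiCompleteMonotonicity.AxialLogConvexity` (support, shared verbatim with route DirichletWindow; closed·proved by `Theorems.AxialLogConvexity_proof`): ledger signature verbatim —
reflection-positivity log-convexity / monotonicity of the axial plaquette correlation. -/
def AxialLogConvexity : Prop :=
  ∀ (G : Type) [Group G] [TopologicalSpace G] [IsTopologicalGroup G] [CompactSpace G] [MeasurableSpace G] [BorelSpace G], Literature.MathematicalPhysics.QuantumFieldTheory.IsCompactSimpleLieGroup G → ∀ r : Literature.MathematicalPhysics.QuantumFieldTheory.LatticeRep G, ∀ β : ℝ, 0 ≤ β → ∀ μ ∈ Literature.MathematicalPhysics.QuantumLattice.infiniteVolumeLimitPoints (d := 4) r.ρ β, ∀ n : ℕ, 0 ≤ Literature.MathematicalPhysics.QuantumLattice.plaquetteCorrFn r.ρ μ ((n : ℤ) • Pi.single (0 : Fin 4) (1 : ℤ)) ∧ Literature.MathematicalPhysics.QuantumLattice.plaquetteCorrFn r.ρ μ (((n + 1 : ℕ) : ℤ) • Pi.single (0 : Fin 4) (1 : ℤ)) ≤ Literature.MathematicalPhysics.QuantumLattice.plaquetteCorrFn r.ρ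 μ ((n : ℤ) • Pi.single (0 : Fin 4) (1 : ℤ)) ∧ Literature.MathematicalPhysics.QuantumLattice.plaquetteCorrFn r.ρ μ ((n : ℤ) • Pi.single (0 : Fin 4) (1 : ℤ)) ≤ (r.N : ℝ) ^ 2 ∧ Literature.MathematicalPhysics.QuantumLattice.plaquetteCorrFn r.ρ μ (((n + 2 : ℕ) : ℤ) • Pi.single (0 : Fin 4) (1 : ℤ)) ^ 2 ≤ Literature.MathematicalPhysics.QuantumLattice.plaquetteCorrFn r.ρ μ (((n + 1 : ℕ) : ℤ) • Pi.single (0 : Fin 4) (1 : ℤ)) * Literature.MathematicalPhysics.QuantumLattice.plaquetteCorrFn r.ρ μ (((n + 3 : ℕ) : ℤ) • Pi.single (0 : Fin 4) (1 : ℤ))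

/-- Record of item stmt-QuantumFields-8941 `XiCompleteMonotonicity.XiDiverges` (support, shared verbatim with route DirichletWindow): ledger signature verbatim —
qualitative payoff `ξ_lat(β) → ∞` uniformly over limit points. -/
def XiDiverges : Prop :=
  ∀ (G : Type) [Group G] [TopologicalSpace G] [IsTopologicalGroup G] [CompactSpace G] [MeasurableSpace G] [BorelSpace G], Literature.MathematicalPhysics.QuantumFieldTheory.IsCompactSimpleLieGroup G → ∀ r : Literature.MathematicalPhysics.QuantumFieldTheory.LatticeRep G, ∀ ε : ℝ, 0 < ε → ∃ β₁ : ℝ, ∀ β : ℝ, β₁ ≤ β → ∀ μ ∈ Literature.MathematicalPhysics.QuantumLattice.infiniteVolumeLimitPoints (d := 4) r.ρ β, ∃ m A : ℝ, 0 < A ∧ 0 ≤ m ∧ m ≤ ε ∧ ∀ n : ℕ, A * Real.exp (-(m * n)) ≤ Literature.MathematicalPhysics.QuantumLattice.plaquetteCorrFn r.ρ μ ((n : ℤ) • Pi.single (0 : Fin 4) (1 : ℤ))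

/-- Record of item stmt-QuantumFields-8942 `XiCompleteMonotonicity.XiDivergesOfPolynomial` (support; closed·proved by `Theorems.xiDivergesOfPolynomial_xiCompleteMonotonicity`, which from now on is typed by THIS record): ledger signature verbatim —
glue `AxialLogConvexity → PolynomialWindow → XiDiverges`. -/
def XiDivergesOfPolynomial : Prop :=
  AxialLogConvexity → PolynomialWindow → XiDiverges

/-- Record of item stmt-QuantumFields-8943 `XiCompleteMonotonicity.XiDivergesOfFixedDistance` (support, shared verbatim with route DirichletWindow; closed·proved by `Theorems.xiDivergesOfFixedDistance_proof`): ledger signature verbatim —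
glue `AxialLogConvexity → FixedDistanceLower → PlaquetteVarianceUpper → XiDiverges`. -/
def XiDivergesOfFixedDistance : Prop :=
  AxialLogConvexity → FixedDistanceLower → PlaquetteVarianceUpper → XiDiverges

end Summit.QuantumFields.YangMills.Theorems.Theses.XiCompleteMonotonicity
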